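import Literature.Geometry.Kaehler.ComplexTorusCentralWeilTypeStablyDegenerate
import Literature.Geometry.Kaehler.ComplexTorusNonSimpleAbelianFourfoldStablyNondegenerate
import Literature.Geometry.Kaehler.ComplexTorusWeilTypeMultiplicities
import Literature.Geometry.Kaehler.ComplexTorusEndomorphismFieldPureMultiplicities
import Literature.Geometry.Kaehler.ComplexTorusHodgeClassesProductHodgeGroup
import Literature.Geometry.Kaehler.ComplexTorusEndomorphismAlgebraProduct
import Literature.Geometry.Kaehler.ComplexTorusLefschetzGroupFiniteProduct
import Literature.Geometry.Kaehler.ComplexTorusHodgeGroupPiAnyNonCMEllipticCurvesProductPowers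
import Literature.Geometry.Kaehler.ComplexTorusStablyNondegenerateProducts
import Literature.Geometry.Kaehler.ComplexTorusEllipticCurveHodgeGroup
import HarnessLib

/-!
# Moonen–Zarhin 1999 Thm. (0.1) (1) for case (a): `X ∼ T × E_τ` with `k = ℚ(τ) ↪ End⁰(T)` carries a CENTRAL
# Weil structure of type `(2, 2)`, hence `Hg(X) ⊊ Sp_D(V,φ)` and condition (D) FAILS; with Thm. (0.1) (4):
# for non-simple abelian fourfolds, (D) ⟺ `Hg = Sp_D` ⟺ not case (a)

Layer `Literature/Geometry/Kaehler`, namespace `Literature.Geometry.Kaehler.ComplexTorus`; lane `lit-hodgefound`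
(Track 2 foundations library), Layer A4; p17, generation 54, row g54-#3 (self-proposed sequel of ✔ g54-#1
`ComplexTorusNonSimpleAbelianFourfoldStablyNondegenerate` — Thm. (0.1) (4): not case (a) ⟹ (D) — and g54-#2
`ComplexTorusCentralWeilTypeStablyDegenerate` — central Weil type ⟹ `Hg(X)(ℝ) ⊊ S(X)(ℝ)` ⟹ not (D)).  THEOREMS ONLY
(no definition, no named fact, net debt 0).

## Source, verbatim

B. Moonen, Yu. G. Zarhin [MoonenZarhin1999LowDim], *Hodge classes on abelian varieties of low dimension*,
Math. Ann. **315** (1999) 711–733 (materialised `paper:arxiv-math_9901113`):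

* Introduction, case (a) (p0001 L77–L80): «The abelian variety `X` is isogenous to a product `X₁ × X₂` where `X₁` is an
  elliptic curve with complex multiplication by an imaginary quadratic field `k` and where `X₂` is a simple abelian
  threefold such that there exists an embedding `k ↪ End⁰(X₂)`.»
* Thm. (0.1) (1) (p0001 L102–L105): «Suppose we are in case (a) or (b). Then the Hodge ring `ℬ•(X)` is generated by the
  subalgebra `𝒟•(X)` of divisor classes together with the space of Weil classes `W_k ⊂ ℬ²(X)`.  The Hodge group `Hg(X)`
  is strictly contained in `Sp_D(V,φ)`.» and (p0001 L123–L125): «in the cases (a), (b) and (c) the Weil classes are really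
  needed to generate the Hodge ring; in these cases we have `𝒟²(X) ≠ ℬ²(X)`.»; Thm. (0.1) (4) (p0001 L120–L122).
* §2 (2.3) (1) (p0005 L126–L129): «if `g = 3` and `End⁰(X) = F` is imaginary quadratic (Type 4(1,1)), `F` necessarily acts
  on the tangent space with multiplicities `(2,1)`.»
* §5 (5.2) (p0008 L129 – p0009 L20): «Suppose furthermore that `k := End⁰(X₁)` is an imaginary quadratic field and that
  there exists an embedding `k ↪ F := End⁰(X₂)`. … Embed `k` as a subfield of `End⁰(X)` such that it acts with
  multiplicities `(2,2)` on the tangent space `T_{X,0}`.  (Our assumption that `X₂` is simple implies that `k` acts on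
  `T_{X₂,0}` with multiplicities `(1,2)` … Therefore, if we fix `End⁰(X₁) = k ↪ End⁰(X₂)` then either `α ↦ (α, α)` or
  `α ↦ (ᾱ, α)` gives an embedding as required.)  Then the space `W_k ⊂ H⁴(X,ℚ)` consists of Hodge classes. … The Hodge
  group acts trivially on `W_k`, i.e., its elements have trivial `k`-linear determinant.»

## Rendering (the tree's vocabulary)

`T` is a simple complex torus `Ψ' : ℝ^κ ≃ E'` of dimension `3` (`|κ| = 6`), `E_τ = ℂ/(ℤτ + ℤ)` (`ellipticPeriod hτ`) has
complex multiplication (`ellipticEnd hτ ≠ ⊥`, i.e. `τ² + pτ + q = 0` over `ℚ`), `k = ℚ[τ] = Algebra.adjoin ℚ {τ} ⊂ ℂ`,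
and «`k ↪ End⁰(T)`» is `Nonempty (ℚ[τ] →ₐ[ℚ] End_ℚ(T))` (for a simple threefold `End⁰(T) = F` is a field, its own centre —
✔ g54-#1 §1).  §1: `k = ℚ(√-d)` for a positive integer `d` (`4q - p² = 4(Im τ)² > 0`, cleared of denominators), and
`±√-d ∈ End_ℚ(E_τ)` are the rational matrices of complex multiplication by `±√-d` (Lange's `End_ℚ(E_τ) = ℚ(τ)`).  §2: block
sums `α₁ ⊕ α₂ ∈ End_ℚ(X₁ × X₂)` — tangent multiplicities add, squares are computed blockwise, and `α₁ ⊕ α₂` is central as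
soon as `Hom(X₁, X₂) = Hom(X₂, X₁) = 0` and each `αᵢ` is central.  §3 = (5.2): the image `α_T ∈ F ⊆ End_ℚ(T)` of `√-d` is
central with `α_T² = -d` and multiplicities `(2,1)` or `(1,2)` ((2.3) (1), the tree's
`IsSimple.finrank_iInf_eigenspace_eq_two_or_of_finrank_eq_three`); choosing the sign of `√-d` on `E_τ` accordingly («either
`α ↦ (α, α)` or `α ↦ (ᾱ, α)`») gives `α = α_T ⊕ (±√-d)` with `α² = -d`, CENTRAL in `End_ℚ(T × E_τ)`, of tangent
multiplicities `(2, 2)`: `IsWeilType (T × E_τ) α d 2`.  By g54-#2 (the `k`-linear determinant: `Hg ⊆ SU_k` but the centre of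
`End⁰` meets `S(X)` outside `SU_k`), `Hg(T × E_τ)(ℝ) ⊊ S(T × E_τ)(ℝ)` for every polarisation and `T × E_τ` — hence every
`X ∼ T × E_τ` — does NOT satisfy (D).  §4 combines this with ✔ g54-#1 (Thm. (0.1) (4) for non-simple fourfolds): for a
non-simple polarised complex abelian fourfold, (D) ⟺ `Hg(X)(ℝ) = S(X)(ℝ)` ⟺ «not case (a)».

NOT here: the first half of (0.1) (1) («`ℬ•(X)` is generated by `𝒟•(X)` and `W_k`», which needs the equality
`Hg(X) = {(u₁,u₂) | u₁ det_k(u₂) = 1}` of (5.2)); case (b) (simple fourfolds); the degree statement `𝒟²(X) ≠ ℬ²(X)` (only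
«some power `Xᵏ` carries a Hodge class which is not a polynomial in divisor classes», through Gordon's Thm. 7.5).

## Contents (all theorems proved)

* §1 `mul_comm_of_mem_endAlgRat_complex` (`End_ℚ` of a one-dimensional torus is commutative),
  `analyticRepHom_apply_eq_mul_of_apply_mulVec`, `finrank_posEigenspace_analyticRepHom_eq_one_of_apply_mulVec`,
  `finrank_posEigenspace_analyticRepHom_eq_zero_of_apply_mulVec`; `four_mul_sub_sq_pos_of_quadratic` (`4q - p² > 0`),
  `exists_ratCast_add_mul_sq_eq_neg_of_quadratic` (`ℚ(τ) = ℚ(√-d)`, `d ∈ ℕ`),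
  **`exists_mem_endAlgRat_ellipticPeriod_apply_mulVec_eq_sqrtNeg_mul`** (`±√-d ∈ End_ℚ(E_τ)`, `√-d ∈ ℚ[τ]`).
* §2 `fromBlocks_diag_mem_endAlgRat_prod`, `analyticRepHom_fromBlocks_apply`, `mem_posEigenspace_analyticRepHom_fromBlocks_iff`,
  **`finrank_posEigenspace_analyticRepHom_fromBlocks`** (multiplicities add),
  `fromBlocks_diag_mul_self_eq_neg_smul_one`, **`fromBlocks_diag_comm_of_homRat_eq_bot`** (centrality on a product).
* §3 **`IsSimple.exists_isWeilType_prod_ellipticPeriod_of_nonempty_algHom`** ((5.2): a central Weil structure of type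
  `(2,2)` on `T × E_τ`), **`IsSimple.exists_divisorClasses_powPeriod_prod_ellipticPeriod_ne_hodgeClasses_of_nonempty_algHom`**,
  **`IsSimple.hodgeGroup_prod_ellipticPeriod_lt_lefschetzGroup_of_nonempty_algHom`** («strictly contained in `Sp_D(V,φ)`»),
  `IsIsogenous.exists_divisorClasses_powPeriod_ne_hodgeClasses_of_prod_ellipticPeriod_of_nonempty_algHom`,
  `IsIsogenous.hodgeGroup_lt_lefschetzGroup_of_prod_ellipticPeriod_of_nonempty_algHom` (any `X ∼ T × E_τ`),
  `isEmpty_algHom_adjoin_endAlgRat_of_forall_divisorClasses_powPeriod_eq_hodgeClasses` ((D) ⟹ not case (a)).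
* §4 (with ✔ g54-#1) **`IsRiemannForm.forall_divisorClasses_powPeriod_eq_hodgeClasses_iff_forall_isEmpty_algHom_of_not_isSimple_of_finrank_eq_four`**
  ((D) ⟺ not case (a)), **`IsRiemannForm.hodgeGroup_eq_lefschetzGroup_iff_forall_divisorClasses_powPeriod_eq_hodgeClasses_of_not_isSimple_of_finrank_eq_four`**
  (`Hg = S` ⟺ (D)), `IsRiemannForm.hodgeGroup_eq_lefschetzGroup_iff_forall_isEmpty_algHom_of_not_isSimple_of_finrank_eq_four`,
  `IsRiemannForm.exists_divisorClasses_powPeriod_ne_hodgeClasses_iff_exists_subtorusPeriod_of_not_isSimple_of_finrank_eq_four`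
  (failure of (D) ⟺ case (a) with witnesses inside `X`).

## References

* [MoonenZarhin1999LowDim] B. Moonen, Yu. G. Zarhin, Math. Ann. 315 (1999), Introduction (a), Thm. (0.1) (1), (4), §2 (2.3) (1),
  §5 (5.2)–(5.5).
* [Lange2023AbelianVarietiesComplex] H. Lange, *Abelian Varieties over the Complex Numbers* (2023), §7.2.4 (Weil type, Exercises
  (4), (7)), §2.4.4 Cor. 2.4.26 (`End_ℚ` of products), §5.1.5 Exercise (1) (`End_ℚ(E_τ)`).
* [vanGeemen1994HodgeAV] B. van Geemen, LNM 1594 (1994), 4.9, 6.9–6.11.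
* [Gordon1999HodgeAVSurvey] B. B. Gordon, Thm. 7.5 (1) ⟺ (2).
* [Shimura1963AnalyticFamilies] G. Shimura, Ann. of Math. 78 (1963), §4 Prop. 14 (multiplicities `(3,0)` excluded).
-/

noncomputable section

open scoped ComplexConjugate
open Module Matrix Complex Function
open Literature.Analysis.Complex Literature.Analysis.Complex.WeilOperator

namespace Literature.Geometry.Kaehler

namespace ComplexTorus

/-! ## §1 One-dimensional tori: `End_ℚ(E)` is commutative; `±√-d ∈ End_ℚ(E_τ)` for a CM curve -/

section DimOne

variable {ι : Type*} [Fintype ι] [DecidableEq ι] (Φ : (ι → ℝ) ≃L[ℝ] ℂ)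

omit [DecidableEq ι] in
/-- Realification of rational matrices is multiplicative. [folklore] -/
private theorem cad_map_ratCast_mul (B C : Matrix ι ι ℚ) :
    (B * C).map (Rat.cast : ℚ → ℝ) = B.map (Rat.cast : ℚ → ℝ) * C.map (Rat.cast : ℚ → ℝ) := by
  have h := Matrix.map_mul (L := B) (M := C) (f := Rat.castHom ℝ)
  simpa only [Rat.coe_castHom] using h

/-- A rational matrix is determined by the action of its realification on `V_ℝ`. [folklore] -/
private theorem cad_eq_of_forall_apply_map_mulVec_eq {A B : Matrix ι ι ℚ}
    (h : ∀ x, Φ (A.map (Rat.cast : ℚ → ℝ) *ᵥ x) = Φ (B.map (Rat.cast : ℚ → ℝ) *ᵥ x)) : A = B := by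
  have hAB : A.map (Rat.cast : ℚ → ℝ) = B.map (Rat.cast : ℚ → ℝ) :=
    Matrix.toLin'.injective (LinearMap.ext fun x ↦ Φ.injective (by rw [Matrix.toLin'_apply, Matrix.toLin'_apply, h]))
  exact Matrix.map_injective Rat.cast_injective hAB

/-- `(-(d·1)) ⊗ ℝ` acts on `V_ℝ = ℂ` as multiplication by `-d`. [folklore] -/
private theorem cad_apply_neg_smul_one_map_mulVec (d : ℕ) (x : ι → ℝ) :
    Φ ((-((d : ℚ) • (1 : Matrix ι ι ℚ))).map (Rat.cast : ℚ → ℝ) *ᵥ x) = -(d : ℂ) * Φ x := by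
  have hmap : (-((d : ℚ) • (1 : Matrix ι ι ℚ))).map (Rat.cast : ℚ → ℝ) = -((d : ℝ) • 1) := by
    ext i j
    simp [Matrix.one_apply, apply_ite (Rat.cast : ℚ → ℝ)]
  rw [hmap, Matrix.neg_mulVec, Matrix.smul_mulVec, Matrix.one_mulVec, map_neg, Φ.map_smul, Complex.real_smul,
    Complex.ofReal_natCast, neg_mul]

/-- **`End_ℚ(E)` of a one-dimensional complex torus `E = ℂ/Λ` is commutative**: every element acts on `V_ℝ = ℂ` as
multiplication by a complex number (Lange's table: `End_ℚ(E) = ℚ` or an imaginary quadratic field).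
[cite: Lange2023AbelianVarietiesComplex, §2.6.1 (table, p. 138) and §5.1.5 Exercise (1)] [cite: MoonenZarhin1999LowDim, Introduction (a) («`k := End⁰(X₁)` an imaginary quadratic field»)] -/
theorem mul_comm_of_mem_endAlgRat_complex {A B : Matrix ι ι ℚ} (hA : A ∈ endAlgRat Φ) (hB : B ∈ endAlgRat Φ) :
    A * B = B * A := by
  obtain ⟨w, hw⟩ := exists_apply_mulVec_eq_mul_of_mem_endAlgRat Φ hA
  obtain ⟨w', hw'⟩ := exists_apply_mulVec_eq_mul_of_mem_endAlgRat Φ hB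
  refine cad_eq_of_forall_apply_map_mulVec_eq Φ fun x ↦ ?_
  rw [cad_map_ratCast_mul, cad_map_ratCast_mul, ← Matrix.mulVec_mulVec, ← Matrix.mulVec_mulVec, hw, hw', hw', hw]
  ring

/-- The analytic representation of `A ∈ End_ℚ(E)` acting on `V_ℝ = ℂ` as `w` is multiplication by `w`.
[cite: Lange2023AbelianVarietiesComplex, §1.1.2 Prop. 1.1.6] -/
theorem analyticRepHom_apply_eq_mul_of_apply_mulVec {A : Matrix ι ι ℚ} (hA : A ∈ endAlgRat Φ) {w : ℂ}
    (h : ∀ x, Φ (A.map (Rat.cast : ℚ → ℝ) *ᵥ x) = w * Φ x) (z : ℂ) : analyticRepHom Φ ⟨A, hA⟩ z = w * z := by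
  obtain ⟨x, rfl⟩ := Φ.surjective z
  rw [analyticRepHom_apply_apply, h]

/-- A rational endomorphism acting as `w` with `w² = -d` squares to `-d·1` in `End_ℚ(E)`. [cite: Lange2023AbelianVarietiesComplex, §1.1.2 Prop. 1.1.6 (`ρ_r` is faithful)] -/
theorem mul_self_eq_neg_smul_one_of_apply_mulVec {A : Matrix ι ι ℚ} {w : ℂ} {d : ℕ}
    (h : ∀ x, Φ (A.map (Rat.cast : ℚ → ℝ) *ᵥ x) = w * Φ x) (hw : w ^ 2 = -(d : ℂ)) :
    A * A = -((d : ℚ) • (1 : Matrix ι ι ℚ)) := by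
  refine cad_eq_of_forall_apply_map_mulVec_eq Φ fun x ↦ ?_
  rw [cad_map_ratCast_mul, ← Matrix.mulVec_mulVec, h, h, cad_apply_neg_smul_one_map_mulVec, ← mul_assoc, ← sq, hw]

/-- If `A ∈ End_ℚ(E)` acts as `+√-d` then its `√-d`-eigenspace is all of `T₀E = ℂ` (multiplicity `1`). [cite: MoonenZarhin1999LowDim, §5 (5.2) (p0009 L1–L8)] -/
theorem posEigenspace_analyticRepHom_eq_top_of_apply_mulVec {A : Matrix ι ι ℚ} (hA : A ∈ endAlgRat Φ) {d : ℝ}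
    (h : ∀ x, Φ (A.map (Rat.cast : ℚ → ℝ) *ᵥ x) = sqrtNeg d * Φ x) :
    posEigenspace (analyticRepHom Φ ⟨A, hA⟩) d = ⊤ := by
  refine eq_top_iff.2 fun z _ ↦ ?_
  rw [mem_posEigenspace_iff, analyticRepHom_apply_eq_mul_of_apply_mulVec Φ hA h, smul_eq_mul]

/-- … so the tangent multiplicity of `√-d` on `E` is `1`. [cite: MoonenZarhin1999LowDim, §5 (5.2) (p0009 L1–L8)] -/
theorem finrank_posEigenspace_analyticRepHom_eq_one_of_apply_mulVec {A : Matrix ι ι ℚ} (hA : A ∈ endAlgRat Φ) {d : ℝ}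
    (h : ∀ x, Φ (A.map (Rat.cast : ℚ → ℝ) *ᵥ x) = sqrtNeg d * Φ x) :
    finrank ℂ ↥(posEigenspace (analyticRepHom Φ ⟨A, hA⟩) d) = 1 := by
  rw [posEigenspace_analyticRepHom_eq_top_of_apply_mulVec Φ hA h, finrank_top, Module.finrank_self]

/-- If `A ∈ End_ℚ(E)` acts as `-√-d` (`d > 0`) then its `√-d`-eigenspace is `0` (multiplicity `0`). [cite: MoonenZarhin1999LowDim, §5 (5.2) (p0009 L1–L8)] -/
theorem posEigenspace_analyticRepHom_eq_bot_of_apply_mulVec {A : Matrix ι ι ℚ} (hA : A ∈ endAlgRat Φ) {d : ℝ}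
    (hd : 0 < d) (h : ∀ x, Φ (A.map (Rat.cast : ℚ → ℝ) *ᵥ x) = -sqrtNeg d * Φ x) :
    posEigenspace (analyticRepHom Φ ⟨A, hA⟩) d = ⊥ := by
  refine (Submodule.eq_bot_iff _).2 fun z hz ↦ ?_
  rw [mem_posEigenspace_iff, analyticRepHom_apply_eq_mul_of_apply_mulVec Φ hA h, smul_eq_mul, neg_mul] at hz
  have h2 : (2 * sqrtNeg d) * z = 0 := by linear_combination -hz
  exact (mul_eq_zero.1 h2).resolve_left (mul_ne_zero two_ne_zero (sqrtNeg_ne_zero hd))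

/-- … so the tangent multiplicity of `√-d` on `E` is `0`. [cite: MoonenZarhin1999LowDim, §5 (5.2) (p0009 L1–L8)] -/
theorem finrank_posEigenspace_analyticRepHom_eq_zero_of_apply_mulVec {A : Matrix ι ι ℚ} (hA : A ∈ endAlgRat Φ) {d : ℝ}
    (hd : 0 < d) (h : ∀ x, Φ (A.map (Rat.cast : ℚ → ℝ) *ᵥ x) = -sqrtNeg d * Φ x) :
    finrank ℂ ↥(posEigenspace (analyticRepHom Φ ⟨A, hA⟩) d) = 0 := by
  rw [posEigenspace_analyticRepHom_eq_bot_of_apply_mulVec Φ hA hd h, finrank_bot]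

/-- The two square roots of `-d` in `ℂ` are `±√-d`. [folklore] -/
private theorem cad_eq_sqrtNeg_or_eq_neg_of_sq_eq {w : ℂ} {d : ℝ} (hd : 0 ≤ d) (hw : w ^ 2 = -(d : ℂ)) :
    w = sqrtNeg d ∨ w = -sqrtNeg d := by
  have hs : sqrtNeg d * sqrtNeg d = -(d : ℂ) := sqrtNeg_mul_self hd
  have h2 : (w - sqrtNeg d) * (w + sqrtNeg d) = 0 := by linear_combination hw - hs
  rcases mul_eq_zero.1 h2 with h3 | h3
  · exact Or.inl (sub_eq_zero.1 h3)
  · exact Or.inr (eq_neg_of_add_eq_zero_left h3)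

variable {τ : ℂ} (hτ : τ.im ≠ 0)

include hτ in
/-- **The discriminant of a CM curve is negative: `4q - p² = 4(Im τ)² > 0`** for `τ² + pτ + q = 0` over `ℚ` with `Im τ ≠ 0`
(`k = ℚ(τ) = ℚ(√(p² - 4q))` is imaginary quadratic). [cite: MoonenZarhin1999LowDim, Introduction (a) («complex multiplication by an imaginary quadratic field `k`»)]
[cite: Lange2023AbelianVarietiesComplex, §5.1.5 Exercise (1)] -/
theorem four_mul_sub_sq_pos_of_quadratic {p q : ℚ} (hq : τ ^ 2 + p * τ + q = 0) : 0 < 4 * q - p ^ 2 := by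
  have hre := congrArg Complex.re hq
  have him := congrArg Complex.im hq
  simp only [sq, Complex.add_re, Complex.mul_re, Complex.ratCast_re, Complex.ratCast_im, zero_mul, sub_zero,
    Complex.zero_re, Complex.add_im, Complex.mul_im, add_zero, Complex.zero_im] at hre him
  have h2 : 2 * τ.re + p = 0 := by
    have : τ.im * (2 * τ.re + p) = 0 := by linear_combination him
    exact (mul_eq_zero.1 this).resolve_left hτ
  have hpos : 0 < τ.im * τ.im := mul_self_pos.2 hτ
  have : (0 : ℝ) < ((4 * q - p ^ 2 : ℚ) : ℝ) := by
    push_cast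
    nlinarith
  exact_mod_cast this

include hτ in
/-- **`k = ℚ(τ) = ℚ(√-d)` with `d` a positive integer**: for `τ² + pτ + q = 0` over `ℚ` there are `a, b ∈ ℚ` and `d ∈ ℕ`,
`d > 0`, with `(a + bτ)² = -d` (namely `a + bτ = D(2τ + p)`, `D` the denominator of `4q - p²`, `d = D² (4q - p²)`).
[cite: MoonenZarhin1999LowDim, Introduction (a)] [cite: vanGeemen1994HodgeAV, 4.9 (`K = ℚ(√-d)`, `d` a positive integer)] -/
theorem exists_ratCast_add_mul_sq_eq_neg_of_quadratic {p q : ℚ} (hq : τ ^ 2 + p * τ + q = 0) :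
    ∃ d : ℕ, 0 < d ∧ ∃ a b : ℚ, ((a : ℂ) + b * τ) ^ 2 = -(d : ℂ) := by
  set r : ℚ := 4 * q - p ^ 2 with hr
  have hr0 : 0 < r := four_mul_sub_sq_pos_of_quadratic hτ hq
  have hn : 0 < r.num := Rat.num_pos.2 hr0
  refine ⟨r.num.toNat * r.den, Nat.mul_pos (by omega) r.den_pos, r.den * p, 2 * r.den, ?_⟩
  have hnum : ((r.num.toNat : ℕ) : ℂ) = ((r.num : ℤ) : ℂ) := by
    rw [← Int.cast_natCast, Int.toNat_of_nonneg hn.le]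
  have hden : (r : ℂ) * (r.den : ℂ) = ((r.num : ℤ) : ℂ) := by
    have h := congrArg (fun x : ℚ ↦ (x : ℂ)) (Rat.mul_den_eq_num r)
    push_cast at h
    exact h
  have hrC : (r : ℂ) = 4 * (q : ℂ) - (p : ℂ) ^ 2 := by rw [hr]; push_cast; ring
  rw [hrC] at hden
  push_cast
  rw [hnum]
  linear_combination (4 * (r.den : ℂ) ^ 2) * hq - (r.den : ℂ) * hden

include hτ in
/-- **`±√-d ∈ End_ℚ(E_τ)` FOR A CM CURVE**: if `E_τ` has complex multiplication then for some positive integer `d` the number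
`√-d = i√d` lies in `k = ℚ[τ] = End⁰(E_τ)`, and there are `β₊, β₋ ∈ End_ℚ(E_τ)` (rational representation) with
`β_±² = -d` acting on `T₀E_τ = ℂ` as multiplication by `+√-d`, `-√-d` (the two embeddings `α ↦ α`, `α ↦ ᾱ` of `k`).
[cite: MoonenZarhin1999LowDim, Introduction (a) and §5 (5.2) (p0009 L4–L8: «either `α ↦ (α, α)` or `α ↦ (ᾱ, α)`»)]
[cite: Lange2023AbelianVarietiesComplex, §5.1.5 Exercise (1) (`End_ℚ(E_τ) = ℚ(τ)`)] -/
theorem exists_mem_endAlgRat_ellipticPeriod_apply_mulVec_eq_sqrtNeg_mul (hE : ellipticEnd hτ ≠ ⊥) :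
    ∃ d : ℕ, 0 < d ∧ sqrtNeg (d : ℝ) ∈ Algebra.adjoin ℚ {τ} ∧
      (∃ β ∈ endAlgRat (ellipticPeriod hτ), β * β = -((d : ℚ) • (1 : Matrix (Fin 2) (Fin 2) ℚ)) ∧
        ∀ x, ellipticPeriod hτ (β.map (Rat.cast : ℚ → ℝ) *ᵥ x) = sqrtNeg (d : ℝ) * ellipticPeriod hτ x) ∧
      (∃ β ∈ endAlgRat (ellipticPeriod hτ), β * β = -((d : ℚ) • (1 : Matrix (Fin 2) (Fin 2) ℚ)) ∧
        ∀ x, ellipticPeriod hτ (β.map (Rat.cast : ℚ → ℝ) *ᵥ x) = -sqrtNeg (d : ℝ) * ellipticPeriod hτ x) := by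
  obtain ⟨p, q, hq⟩ := (ellipticEnd_ne_bot_iff hτ).1 hE
  obtain ⟨d, hd, a, b, hw⟩ := exists_ratCast_add_mul_sq_eq_neg_of_quadratic hτ hq
  have hw' : ((a : ℂ) + b * τ) ^ 2 = -((d : ℝ) : ℂ) := by rw [hw, Complex.ofReal_natCast]
  have hss : sqrtNeg (d : ℝ) ^ 2 = -(d : ℂ) := by
    rw [sq, sqrtNeg_mul_self (Nat.cast_nonneg d), Complex.ofReal_natCast]
  -- `√-d = a₀ + b₀ τ ∈ ℚ(τ)` for suitable signs
  obtain ⟨a₀, b₀, h₀⟩ : ∃ a₀ b₀ : ℚ, (a₀ : ℂ) + b₀ * τ = sqrtNeg (d : ℝ) := by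
    rcases cad_eq_sqrtNeg_or_eq_neg_of_sq_eq (Nat.cast_nonneg d) hw' with hs | hs
    · exact ⟨a, b, hs⟩
    · exact ⟨-a, -b, by push_cast; linear_combination -hs⟩
  have hmem : ∀ a' b' : ℚ, (a' : ℂ) + b' * τ ∈ Algebra.adjoin ℚ {τ} := fun a' b' ↦ by
    refine add_mem ?_ ?_
    · simpa only [eq_ratCast] using Subalgebra.algebraMap_mem (Algebra.adjoin ℚ {τ}) a'
    · rw [← Rat.smul_def]
      exact Subalgebra.smul_mem _ (Algebra.self_mem_adjoin_singleton ℚ τ) b'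
  -- the matrices of multiplication by `a₀ + b₀ τ = √-d` and by `-(a₀ + b₀ τ) = -√-d` on the lattice basis `(τ, 1)`
  have hact : ∀ a' b' : ℚ, ∀ x, ellipticPeriod hτ
      ((!![a' - b' * p, b'; -b' * q, a'] : Matrix (Fin 2) (Fin 2) ℚ).map (Rat.cast : ℚ → ℝ) *ᵥ x) =
        ((a' : ℂ) + b' * τ) * ellipticPeriod hτ x :=
    fun a' b' x ↦ ellipticPeriod_map_ratCast_mulVec_of_quadratic hτ hq a' b' x
  have hend : ∀ a' b' : ℚ, (!![a' - b' * p, b'; -b' * q, a'] : Matrix (Fin 2) (Fin 2) ℚ) ∈ endAlgRat (ellipticPeriod hτ) :=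
    fun a' b' ↦ (mem_endAlgRat_ellipticPeriod_iff_of_quadratic hτ hq).2 ⟨a', b', rfl⟩
  have hp0 : ∀ x, ellipticPeriod hτ
      ((!![a₀ - b₀ * p, b₀; -b₀ * q, a₀] : Matrix (Fin 2) (Fin 2) ℚ).map (Rat.cast : ℚ → ℝ) *ᵥ x) =
        sqrtNeg (d : ℝ) * ellipticPeriod hτ x := fun x ↦ by rw [hact, h₀]
  have hm0 : ∀ x, ellipticPeriod hτ
      ((!![-a₀ - -b₀ * p, -b₀; -(-b₀) * q, -a₀] : Matrix (Fin 2) (Fin 2) ℚ).map (Rat.cast : ℚ → ℝ) *ᵥ x) =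
        -sqrtNeg (d : ℝ) * ellipticPeriod hτ x := fun x ↦ by
    rw [hact, ← h₀]
    push_cast
    ring
  have hss' : (-sqrtNeg (d : ℝ)) ^ 2 = -(d : ℂ) := by rw [_root_.neg_sq, hss]
  exact ⟨d, hd, h₀ ▸ hmem a₀ b₀,
    ⟨_, hend a₀ b₀, mul_self_eq_neg_smul_one_of_apply_mulVec (ellipticPeriod hτ) hp0 hss, hp0⟩,
    ⟨_, hend (-a₀) (-b₀), mul_self_eq_neg_smul_one_of_apply_mulVec (ellipticPeriod hτ) hm0 hss', hm0⟩⟩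

end DimOne

/-! ## §2 Block sums `α₁ ⊕ α₂ ∈ End_ℚ(X₁ × X₂)`: multiplicities add, squares blockwise, centrality -/

section Blocks

variable {ι₁ ι₂ : Type*} [Fintype ι₁] [Fintype ι₂] [DecidableEq ι₁] [DecidableEq ι₂]
  {E₁ E₂ : Type*} [NormedAddCommGroup E₁] [NormedSpace ℂ E₁] [NormedAddCommGroup E₂] [NormedSpace ℂ E₂]
  (Φ₁ : (ι₁ → ℝ) ≃L[ℝ] E₁) (Φ₂ : (ι₂ → ℝ) ≃L[ℝ] E₂)

/-- `α₁ ⊕ α₂ ∈ End_ℚ(X₁ × X₂)` for `αᵢ ∈ End_ℚ(Xᵢ)` (the product endomorphism). [cite: Lange2023AbelianVarietiesComplex, §2.4.4 Cor. 2.4.26 (proof), p. 124] -/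
theorem fromBlocks_diag_mem_endAlgRat_prod {A : Matrix ι₁ ι₁ ℚ} {B : Matrix ι₂ ι₂ ℚ} (hA : A ∈ endAlgRat Φ₁)
    (hB : B ∈ endAlgRat Φ₂) : Matrix.fromBlocks A 0 0 B ∈ endAlgRat (prodPeriod Φ₁ Φ₂) :=
  (fromBlocks_mem_endAlgRat_prod_iff Φ₁ Φ₂).2 ⟨hA, Submodule.zero_mem _, Submodule.zero_mem _, hB⟩

/-- **`ρₐ(α₁ ⊕ α₂) = ρₐ(α₁) × ρₐ(α₂)`** on `T₀(X₁ × X₂) = T₀X₁ × T₀X₂`. [cite: Lange2023AbelianVarietiesComplex, §2.4.4 Cor. 2.4.26 (proof), p. 124]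
[cite: MoonenZarhin1999LowDim, §5 (5.2) (p0009 L4–L8: the embedding `α ↦ (α, α)` / `α ↦ (ᾱ, α)` into `End⁰(X₁) × End⁰(X₂)`)] -/
theorem analyticRepHom_fromBlocks_apply {A : Matrix ι₁ ι₁ ℚ} {B : Matrix ι₂ ι₂ ℚ} (hA : A ∈ endAlgRat Φ₁)
    (hB : B ∈ endAlgRat Φ₂) (hAB : Matrix.fromBlocks A 0 0 B ∈ endAlgRat (prodPeriod Φ₁ Φ₂)) (v : E₁ × E₂) :
    analyticRepHom (prodPeriod Φ₁ Φ₂) ⟨Matrix.fromBlocks A 0 0 B, hAB⟩ v =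
      (analyticRepHom Φ₁ ⟨A, hA⟩ v.1, analyticRepHom Φ₂ ⟨B, hB⟩ v.2) := by
  have h1 : analyticRepHom (prodPeriod Φ₁ Φ₂) ⟨Matrix.fromBlocks A 0 0 B, hAB⟩ v =
      ((analyticRepHom (prodPeriod Φ₁ Φ₂) ⟨Matrix.fromBlocks A 0 0 B, hAB⟩).restrictScalars ℝ) v := rfl
  rw [h1, restrictScalars_analyticRepHom (prodPeriod Φ₁ Φ₂) hAB, Matrix.fromBlocks_map,
    Matrix.map_zero _ Rat.cast_zero, Matrix.map_zero _ Rat.cast_zero, analyticRepReal_prodPeriod_fromBlocks,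
    ContinuousLinearMap.coe_prodMap', Prod.map_apply, ← restrictScalars_analyticRepHom Φ₁ hA,
    ← restrictScalars_analyticRepHom Φ₂ hB]
  rfl

/-- The `√-d`-eigenspace of `ρₐ(α₁ ⊕ α₂)` is the product of the `√-d`-eigenspaces. [cite: MoonenZarhin1999LowDim, §5 (5.2) (p0009 L1–L8: multiplicities `(2,2)` from `(1,2)` on `X₂` and the sign on `X₁`)] -/
theorem mem_posEigenspace_analyticRepHom_fromBlocks_iff {A : Matrix ι₁ ι₁ ℚ} {B : Matrix ι₂ ι₂ ℚ} (hA : A ∈ endAlgRat Φ₁)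
    (hB : B ∈ endAlgRat Φ₂) (hAB : Matrix.fromBlocks A 0 0 B ∈ endAlgRat (prodPeriod Φ₁ Φ₂)) (d : ℝ) (v : E₁ × E₂) :
    v ∈ posEigenspace (analyticRepHom (prodPeriod Φ₁ Φ₂) ⟨Matrix.fromBlocks A 0 0 B, hAB⟩) d ↔
      v.1 ∈ posEigenspace (analyticRepHom Φ₁ ⟨A, hA⟩) d ∧ v.2 ∈ posEigenspace (analyticRepHom Φ₂ ⟨B, hB⟩) d := by
  rw [mem_posEigenspace_iff, mem_posEigenspace_iff, mem_posEigenspace_iff, analyticRepHom_fromBlocks_apply Φ₁ Φ₂ hA hB hAB,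
    Prod.ext_iff, Prod.smul_fst, Prod.smul_snd]

/-- **TANGENT MULTIPLICITIES ADD ON A PRODUCT**: the multiplicity of `√-d` for `α₁ ⊕ α₂` on `T₀(X₁ × X₂)` is the sum of the
multiplicities of `√-d` for `αᵢ` on `T₀Xᵢ` («it acts with multiplicities `(2,2)` on the tangent space `T_{X,0}`» from
`(1,2)` on `X₂` and `(1,0)` on `X₁`). [cite: MoonenZarhin1999LowDim, §5 (5.2) (p0009 L1–L8)] -/
theorem finrank_posEigenspace_analyticRepHom_fromBlocks [FiniteDimensional ℂ E₁] [FiniteDimensional ℂ E₂]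
    {A : Matrix ι₁ ι₁ ℚ} {B : Matrix ι₂ ι₂ ℚ} (hA : A ∈ endAlgRat Φ₁) (hB : B ∈ endAlgRat Φ₂)
    (hAB : Matrix.fromBlocks A 0 0 B ∈ endAlgRat (prodPeriod Φ₁ Φ₂)) (d : ℝ) :
    finrank ℂ ↥(posEigenspace (analyticRepHom (prodPeriod Φ₁ Φ₂) ⟨Matrix.fromBlocks A 0 0 B, hAB⟩) d) =
      finrank ℂ ↥(posEigenspace (analyticRepHom Φ₁ ⟨A, hA⟩) d) +
        finrank ℂ ↥(posEigenspace (analyticRepHom Φ₂ ⟨B, hB⟩) d) := by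
  set P := posEigenspace (analyticRepHom (prodPeriod Φ₁ Φ₂) ⟨Matrix.fromBlocks A 0 0 B, hAB⟩) d
  set P₁ := posEigenspace (analyticRepHom Φ₁ ⟨A, hA⟩) d
  set P₂ := posEigenspace (analyticRepHom Φ₂ ⟨B, hB⟩) d
  have hP : ∀ v, v ∈ P ↔ v.1 ∈ P₁ ∧ v.2 ∈ P₂ := mem_posEigenspace_analyticRepHom_fromBlocks_iff Φ₁ Φ₂ hA hB hAB d
  let e : P ≃ₗ[ℂ] P₁ × P₂ :=
    { toFun := fun v ↦ (⟨v.1.1, ((hP _).1 v.2).1⟩, ⟨v.1.2, ((hP _).1 v.2).2⟩)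
      map_add' := fun _ _ ↦ rfl
      map_smul' := fun _ _ ↦ rfl
      invFun := fun w ↦ ⟨(w.1.1, w.2.1), (hP _).2 ⟨w.1.2, w.2.2⟩⟩
      left_inv := fun _ ↦ rfl
      right_inv := fun _ ↦ rfl }
  rw [e.finrank_eq, Module.finrank_prod]

omit [DecidableEq ι₁] [DecidableEq ι₂] in
/-- `(α₁ ⊕ α₂)(α₁' ⊕ α₂') = α₁α₁' ⊕ α₂α₂'`. [folklore] -/
private theorem cad_fromBlocks_diag_mul_fromBlocks_diag (A A' : Matrix ι₁ ι₁ ℚ) (B B' : Matrix ι₂ ι₂ ℚ) :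
    Matrix.fromBlocks A 0 0 B * Matrix.fromBlocks A' 0 0 B' = Matrix.fromBlocks (A * A') 0 0 (B * B') := by
  rw [Matrix.fromBlocks_multiply]
  simp

/-- **`(α₁ ⊕ α₂)² = -d`** when `α₁² = -d` and `α₂² = -d` (the diagonal image of `√-d` in `End⁰(X₁) × End⁰(X₂)`).
[cite: MoonenZarhin1999LowDim, §5 (5.2) (p0009 L1–L8: «Embed `k` as a subfield of `End⁰(X)`»)] -/
theorem fromBlocks_diag_mul_self_eq_neg_smul_one {A : Matrix ι₁ ι₁ ℚ} {B : Matrix ι₂ ι₂ ℚ} {d : ℚ}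
    (hA : A * A = -(d • (1 : Matrix ι₁ ι₁ ℚ))) (hB : B * B = -(d • (1 : Matrix ι₂ ι₂ ℚ))) :
    Matrix.fromBlocks A 0 0 B * Matrix.fromBlocks A 0 0 B = -(d • (1 : Matrix (ι₁ ⊕ ι₂) (ι₁ ⊕ ι₂) ℚ)) := by
  rw [cad_fromBlocks_diag_mul_fromBlocks_diag, hA, hB, ← Matrix.fromBlocks_one, Matrix.fromBlocks_smul, Matrix.fromBlocks_neg]
  simp only [smul_zero, neg_zero]

/-- **CENTRALITY ON A PRODUCT WITHOUT CROSS HOMOMORPHISMS**: if `Hom_ℚ(X₁, X₂) = Hom_ℚ(X₂, X₁) = 0` (so that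
`End_ℚ(X₁ × X₂) = End_ℚ(X₁) × End_ℚ(X₂)`) and `αᵢ` is central in `End_ℚ(Xᵢ)`, then `α₁ ⊕ α₂` is central in
`End_ℚ(X₁ × X₂)`. [cite: Lange2023AbelianVarietiesComplex, §2.4.4 Cor. 2.4.26 (proof), p. 124]
[cite: MoonenZarhin1999LowDim, §3 (3.8) («an embedding of `k` into the center of `End⁰(X)`») and §5 (5.2)] -/
theorem fromBlocks_diag_comm_of_homRat_eq_bot {A : Matrix ι₁ ι₁ ℚ} {B : Matrix ι₂ ι₂ ℚ}
    (h₁₂ : homRat Φ₂ Φ₁ = ⊥) (h₂₁ : homRat Φ₁ Φ₂ = ⊥)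
    (hA : ∀ A' ∈ endAlgRat Φ₁, A * A' = A' * A) (hB : ∀ B' ∈ endAlgRat Φ₂, B * B' = B' * B)
    {M : Matrix (ι₁ ⊕ ι₂) (ι₁ ⊕ ι₂) ℚ} (hM : M ∈ endAlgRat (prodPeriod Φ₁ Φ₂)) :
    Matrix.fromBlocks A 0 0 B * M = M * Matrix.fromBlocks A 0 0 B := by
  obtain ⟨h11, h12, h21, h22⟩ := (mem_endAlgRat_prod_iff Φ₁ Φ₂ M).1 hM
  rw [h₁₂, Submodule.mem_bot] at h12
  rw [h₂₁, Submodule.mem_bot] at h21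
  rw [← Matrix.fromBlocks_toBlocks M, h12, h21, cad_fromBlocks_diag_mul_fromBlocks_diag, cad_fromBlocks_diag_mul_fromBlocks_diag,
    hA _ h11, hB _ h22]

end Blocks

/-! ## §3 Case (a): `T × E_τ` with `k = ℚ(τ) ↪ End⁰(T)` is of CENTRAL Weil type `(2, 2)`; `Hg ⊊ Sp_D`; (D) fails -/

section CaseA

open WeilHermitian

variable {κ : Type} [Fintype κ] [DecidableEq κ] {E' : Type} [NormedAddCommGroup E'] [NormedSpace ℂ E']
  [FiniteDimensional ℂ E'] {Ψ' : (κ → ℝ) ≃L[ℝ] E'} {τ : ℂ}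

/-- **MZ99 (5.2): IN CASE (a), `T × E_τ` IS A COMPLEX TORUS OF CENTRAL WEIL TYPE WITH MULTIPLICITIES `(2, 2)`.**  Let `T` be a
simple complex torus of dimension `3`, `E_τ` an elliptic curve with complex multiplication, and suppose `k = ℚ[τ] = End⁰(E_τ)`
embeds into `End⁰(T)` (`= F`, a field).  Then for a positive integer `d` with `k = ℚ(√-d)` there is `α ∈ End_ℚ(T × E_τ)`,
`α² = -d`, CENTRAL in `End_ℚ(T × E_τ)`, whose `√-d`-eigenspace on `T₀(T × E_τ) = ℂ⁴` has dimension `2`: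
`α = α_T ⊕ (±√-d)` with `α_T ∈ F` the image of `√-d` (multiplicities `(2,1)` or `(1,2)` by (2.3) (1)) and the sign on `E_τ`
chosen accordingly — «Embed `k` as a subfield of `End⁰(X)` such that it acts with multiplicities `(2,2)` on the tangent space
`T_{X,0}` … either `α ↦ (α, α)` or `α ↦ (ᾱ, α)` gives an embedding as required.»
[cite: MoonenZarhin1999LowDim, §5 (5.2) (p0008 L129 – p0009 L8) and §2 (2.3) (1) (p0005 L126–L129)] [cite: Lange2023AbelianVarietiesComplex, §7.2.4 (p. 334: definition of Weil type)]
[cite: Shimura1963AnalyticFamilies, §4 Prop. 14] -/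
theorem IsSimple.exists_isWeilType_prod_ellipticPeriod_of_nonempty_algHom (hT : IsSimple Ψ') (h3 : finrank ℂ E' = 3)
    (hτ : τ.im ≠ 0) (hE : ellipticEnd hτ ≠ ⊥) (hemb : Nonempty (Algebra.adjoin ℚ {τ} →ₐ[ℚ] endAlgRat Ψ')) :
    ∃ (α : Matrix (κ ⊕ Fin 2) (κ ⊕ Fin 2) ℚ) (d : ℕ), IsWeilType (prodPeriod Ψ' (ellipticPeriod hτ)) α d 2 ∧
      ∀ M ∈ endAlgRat (prodPeriod Ψ' (ellipticPeriod hτ)), α * M = M * α := by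
  have hcard : Fintype.card κ = 6 := by rw [card_eq_two_mul_finrank Ψ', h3]
  haveI : Nonempty κ := Fintype.card_pos_iff.1 (by omega)
  -- §1: `k = ℚ(τ) = ℚ(√-d)` and `±√-d ∈ End_ℚ(E_τ)`
  obtain ⟨d, hd, hsmem, ⟨βp, hβp, hβpsq, hβpact⟩, ⟨βm, hβm, hβmsq, hβmact⟩⟩ :=
    exists_mem_endAlgRat_ellipticPeriod_apply_mulVec_eq_sqrtNeg_mul hτ hE
  haveI : NeZero d := ⟨hd.ne'⟩
  -- `α_T ∈ F = centre of End⁰(T)`, the image of `√-d ∈ k` under `k ↪ F`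
  obtain ⟨g⟩ := (hT.nonempty_algHom_endAlgRat_iff_nonempty_algHom_centerField_of_finrank_eq_three h3 _).1 hemb
  set s : ↥(Algebra.adjoin ℚ {τ}) := ⟨sqrtNeg (d : ℝ), hsmem⟩ with hs_def
  set αT : Matrix κ κ ℚ := centerField.val Ψ' hT (g s) with hαT_def
  have hαT : αT ∈ endAlgRat Ψ' := centerField.val_mem Ψ' hT _
  have hαTc : ∀ A' ∈ endAlgRat Ψ', αT * A' = A' * αT := fun A' hA' ↦ centerField.val_comm Ψ' hT _ hA'
  have hss : s * s = algebraMap ℚ ↥(Algebra.adjoin ℚ {τ}) (-(d : ℚ)) := by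
    apply Subtype.ext
    rw [MulMemClass.coe_mul, Subalgebra.coe_algebraMap, hs_def, sqrtNeg_mul_self (Nat.cast_nonneg _), eq_ratCast,
      Rat.cast_neg, Rat.cast_natCast, Complex.ofReal_natCast]
  have hαTsq : αT * αT = -((d : ℚ) • (1 : Matrix κ κ ℚ)) := by
    rw [hαT_def, ← map_mul, ← map_mul, hss, AlgHom.commutes, ← centerField.valAlgHom_apply, AlgHom.commutes,
      Algebra.algebraMap_eq_smul_one, neg_smul]
  -- (2.3) (1): the multiplicities of `α_T` on `T₀T` are `(2,1)` or `(1,2)`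
  haveI : NumberField (RatSqrtNeg d) := NumberField.mk
  let αm : SqrtNegMat κ d := ⟨αT, hαTsq⟩
  obtain ⟨σ, hσ⟩ := exists_embedding_omega_eq_sqrtNeg (d := d)
  have hmult := hT.finrank_iInf_eigenspace_eq_two_or_of_finrank_eq_three Ψ' (SqrtNegMat.toMat αm)
    (SqrtNegMat.toMat_mem_endAlgRat αm Ψ' hαT) (QuadraticAlgebra.finrank_eq_two _ _) h3 σ
  have hpos : finrank ℂ ↥(posEigenspace (analyticRepHom Ψ' ⟨αT, hαT⟩) (d : ℝ)) = 2 ∨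
      finrank ℂ ↥(posEigenspace (analyticRepHom Ψ' ⟨αT, hαT⟩) (d : ℝ)) = 1 := by
    -- (the number-field statement, re-elaborated for `K = ℚ(√-d)`; `T_σ` is the `√-d`-eigenspace of `ρ(α_T)`)
    have key : finrank ℂ ↥(⨅ y : RatSqrtNeg d, Module.End.eigenspace
        ((analyticRepHom Ψ' ⟨SqrtNegMat.toMat αm y, SqrtNegMat.toMat_mem_endAlgRat αm Ψ' hαT y⟩ : E' →L[ℂ] E') :
          E' →ₗ[ℂ] E') (σ y)) = 2 ∨
      finrank ℂ ↥(⨅ y : RatSqrtNeg d, Module.End.eigenspace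
        ((analyticRepHom Ψ' ⟨SqrtNegMat.toMat αm y, SqrtNegMat.toMat_mem_endAlgRat αm Ψ' hαT y⟩ : E' →L[ℂ] E') :
          E' →ₗ[ℂ] E') (σ y)) = 1 := hmult.imp (fun h ↦ h.1) (fun h ↦ h.1)
    rw [iInf_eigenspace_analyticRepHom_toMat_eq Ψ' αm hαT σ, hσ] at key
    exact key
  -- choose the sign of `√-d` on `E_τ` so that the multiplicities of `α = α_T ⊕ β` are `(2, 2)`
  obtain ⟨β, hβ, hβsq, hβfin⟩ : ∃ (β : Matrix (Fin 2) (Fin 2) ℚ) (hβ : β ∈ endAlgRat (ellipticPeriod hτ)),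
      β * β = -((d : ℚ) • (1 : Matrix (Fin 2) (Fin 2) ℚ)) ∧
        finrank ℂ ↥(posEigenspace (analyticRepHom Ψ' ⟨αT, hαT⟩) (d : ℝ)) +
          finrank ℂ ↥(posEigenspace (analyticRepHom (ellipticPeriod hτ) ⟨β, hβ⟩) (d : ℝ)) = 2 := by
    rcases hpos with h2 | h1
    · exact ⟨βm, hβm, hβmsq, by
        rw [h2, finrank_posEigenspace_analyticRepHom_eq_zero_of_apply_mulVec (ellipticPeriod hτ) hβm
          (Nat.cast_pos.2 hd) hβmact]⟩
    · exact ⟨βp, hβp, hβpsq, by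
        rw [h1, finrank_posEigenspace_analyticRepHom_eq_one_of_apply_mulVec (ellipticPeriod hτ) hβp hβpact]⟩
  have hαmem : Matrix.fromBlocks αT 0 0 β ∈ endAlgRat (prodPeriod Ψ' (ellipticPeriod hτ)) :=
    fromBlocks_diag_mem_endAlgRat_prod Ψ' (ellipticPeriod hτ) hαT hβ
  refine ⟨Matrix.fromBlocks αT 0 0 β, d, ?_, ?_⟩
  · exact
      { mem_endAlgRat := hαmem
        mul_self := fromBlocks_diag_mul_self_eq_neg_smul_one hαTsq hβsq
        pos := hd
        pos_dim := Nat.succ_pos 1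
        finrank_eq := by rw [Module.finrank_prod, h3, Module.finrank_self]
        finrank_posEigenspace := by
          rw [finrank_posEigenspace_analyticRepHom_fromBlocks Ψ' (ellipticPeriod hτ) hαT hβ hαmem, hβfin] }
  · -- `End_ℚ(T × E_τ) = End_ℚ(T) × End_ℚ(E_τ)`: no homomorphisms between a simple threefold and a curve
    have hE1 : IsSimple (ellipticPeriod hτ) := isSimple_ellipticPeriod hτ
    have h12 : homRat (ellipticPeriod hτ) Ψ' = ⊥ :=
      hE1.homRat_eq_bot_of_card_ne hT (by rw [Fintype.card_fin, hcard]; decide)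
    have h21 : homRat Ψ' (ellipticPeriod hτ) = ⊥ :=
      hT.homRat_eq_bot_of_card_ne hE1 (by rw [Fintype.card_fin, hcard]; decide)
    exact fun M hM ↦ fromBlocks_diag_comm_of_homRat_eq_bot Ψ' (ellipticPeriod hτ) h12 h21 hαTc
      (fun B' hB' ↦ mul_comm_of_mem_endAlgRat_complex (ellipticPeriod hτ) hβ hB') hM

/-- **CASE (a) ⟹ `T × E_τ` DOES NOT SATISFY (D)**: for `T` a simple complex abelian threefold and `E_τ` a CM curve with
`ℚ[τ] ↪ End⁰(T)`, some power `(T × E_τ)ᵏ` carries a Hodge class which is not a polynomial in divisor classes («in these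
cases we have `𝒟²(X) ≠ ℬ²(X)`»: the Weil classes `W_k`). [cite: MoonenZarhin1999LowDim, Thm. (0.1) (1) (p0001 L102–L105, L123–L125) and §5 (5.2)–(5.3)]
[cite: Gordon1999HodgeAVSurvey, Thm. 7.5 (1) ⟺ (2)] -/
theorem IsSimple.exists_divisorClasses_powPeriod_prod_ellipticPeriod_ne_hodgeClasses_of_nonempty_algHom (hT : IsSimple Ψ')
    (hA : IsAbelianVariety Ψ') (h3 : finrank ℂ E' = 3) (hτ : τ.im ≠ 0) (hE : ellipticEnd hτ ≠ ⊥)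
    (hemb : Nonempty (Algebra.adjoin ℚ {τ} →ₐ[ℚ] endAlgRat Ψ')) :
    ∃ k p : ℕ, divisorClasses (powPeriod (prodPeriod Ψ' (ellipticPeriod hτ)) k) p ≠
      hodgeClasses (powPeriod (prodPeriod Ψ' (ellipticPeriod hτ)) k) p := by
  obtain ⟨α, d, hW, hcent⟩ := hT.exists_isWeilType_prod_ellipticPeriod_of_nonempty_algHom h3 hτ hE hemb
  exact hW.exists_divisorClasses_powPeriod_ne_hodgeClasses_of_forall_comm (hA.prod (isAbelianVariety_ellipticPeriod hτ)) hcent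

/-- **THM. (0.1) (1), CASE (a): «THE HODGE GROUP `Hg(X)` IS STRICTLY CONTAINED IN `Sp_D(V,φ)`»** for `X = T × E_τ` (`T` a
simple abelian threefold, `E_τ` a CM curve, `ℚ[τ] ↪ End⁰(T)`) and EVERY polarisation `φ` of `X` (real points: `Hg(X)(ℝ) ⊊
S(X)(ℝ)`, `S(X)` the centraliser of `End⁰(X)` in `Sp(V,φ)` — independent of `φ`). [cite: MoonenZarhin1999LowDim, Thm. (0.1) (1) (p0001 L104–L105) and §5 (5.2) (p0009 L9–L33)]
[cite: Lange2023AbelianVarietiesComplex, §7.2.4 Exercise (4)(a)] -/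
theorem IsSimple.hodgeGroup_prod_ellipticPeriod_lt_lefschetzGroup_of_nonempty_algHom (hT : IsSimple Ψ') (h3 : finrank ℂ E' = 3)
    (hτ : τ.im ≠ 0) (hE : ellipticEnd hτ ≠ ⊥) (hemb : Nonempty (Algebra.adjoin ℚ {τ} →ₐ[ℚ] endAlgRat Ψ'))
    {θ : (E' × ℂ) [⋀^Fin 2]→L[ℝ] ℝ} (hθ : IsRiemannForm (prodPeriod Ψ' (ellipticPeriod hτ)) θ) :
    hodgeGroup (prodPeriod Ψ' (ellipticPeriod hτ)) < lefschetzGroup (prodPeriod Ψ' (ellipticPeriod hτ)) θ := by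
  obtain ⟨α, d, hW, hcent⟩ := hT.exists_isWeilType_prod_ellipticPeriod_of_nonempty_algHom h3 hτ hE hemb
  obtain ⟨θ₀, hθ₀, hlt⟩ := hW.exists_isRiemannForm_hodgeGroup_lt_lefschetzGroup_of_forall_comm ⟨θ, hθ⟩ hcent
  rwa [hθ₀.lefschetzGroup_eq hθ] at hlt

variable {κ₀ : Type*} [Fintype κ₀] [DecidableEq κ₀] {E₀ : Type*} [NormedAddCommGroup E₀] [NormedSpace ℂ E₀]
  {Ψ : (κ₀ → ℝ) ≃L[ℝ] E₀} {η : E₀ [⋀^Fin 2]→L[ℝ] ℝ}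

/-- **THM. (0.1) (1) ∕ (4), CASE (a): EVERY `X ∼ T × E_τ` IN CASE (a) FAILS CONDITION (D)** — some power `Xᵏ` carries a Hodge
class which is not a polynomial in divisor classes ((D) is an isogeny invariant). [cite: MoonenZarhin1999LowDim, Thm. (0.1) (1), (4) (p0001 L102–L105, L120–L125) and §5 (5.2)–(5.3)]
[cite: Lange2023AbelianVarietiesComplex, §7.3.3 Exercise (1)(b)] -/
theorem IsIsogenous.exists_divisorClasses_powPeriod_ne_hodgeClasses_of_prod_ellipticPeriod_of_nonempty_algHom {hτ : τ.im ≠ 0}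
    (hiso : IsIsogenous Ψ (prodPeriod Ψ' (ellipticPeriod hτ))) (hT : IsSimple Ψ') (hA : IsAbelianVariety Ψ')
    (h3 : finrank ℂ E' = 3) (hE : ellipticEnd hτ ≠ ⊥) (hemb : Nonempty (Algebra.adjoin ℚ {τ} →ₐ[ℚ] endAlgRat Ψ')) :
    ∃ k p : ℕ, divisorClasses (powPeriod Ψ k) p ≠ hodgeClasses (powPeriod Ψ k) p := by
  by_contra h
  push Not at h
  obtain ⟨k, p, hkp⟩ :=
    hT.exists_divisorClasses_powPeriod_prod_ellipticPeriod_ne_hodgeClasses_of_nonempty_algHom hA h3 hτ hE hemb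
  exact hkp (hiso.forall_powPeriod_divisorClasses_eq_hodgeClasses_iff.1 h k p)

/-- **THM. (0.1) (1), CASE (a), FOR EVERY POLARISED `X ∼ T × E_τ`: `Hg(X)(ℝ) ⊊ S(X)(ℝ)`** («strictly contained in
`Sp_D(V,φ)`»; `Hg = S` is an isogeny invariant of polarised tori). [cite: MoonenZarhin1999LowDim, Thm. (0.1) (1) (p0001 L104–L105)]
[cite: Lange2023AbelianVarietiesComplex, §7.2.4 Exercise (4)] -/
theorem IsIsogenous.hodgeGroup_lt_lefschetzGroup_of_prod_ellipticPeriod_of_nonempty_algHom {hτ : τ.im ≠ 0}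
    (hiso : IsIsogenous Ψ (prodPeriod Ψ' (ellipticPeriod hτ))) (hη : IsRiemannForm Ψ η) (hT : IsSimple Ψ')
    (hA : IsAbelianVariety Ψ') (h3 : finrank ℂ E' = 3) (hE : ellipticEnd hτ ≠ ⊥)
    (hemb : Nonempty (Algebra.adjoin ℚ {τ} →ₐ[ℚ] endAlgRat Ψ')) : hodgeGroup Ψ < lefschetzGroup Ψ η := by
  obtain ⟨θ, hθ⟩ := hA.prod (isAbelianVariety_ellipticPeriod hτ)
  have hlt := hT.hodgeGroup_prod_ellipticPeriod_lt_lefschetzGroup_of_nonempty_algHom h3 hτ hE hemb hθ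
  refine lt_of_le_of_ne hη.hodgeGroup_le_lefschetzGroup fun heq ↦ hlt.ne ?_
  exact (hiso.hodgeGroup_eq_lefschetzGroup_iff hη hθ).1 heq

/-- **(D) ⟹ NOT CASE (a)**: if `X` satisfies condition (D) (`ℬ•(Xⁿ) = 𝒟•(Xⁿ)` for all `n`), then for every simple complex
abelian threefold `T` and CM curve `E_τ` with `X ∼ T × E_τ` there is NO embedding `ℚ[τ] ↪ End⁰(T)`.
[cite: MoonenZarhin1999LowDim, Thm. (0.1) (1), (4) (p0001 L102–L105, L120–L122)] -/
theorem isEmpty_algHom_adjoin_endAlgRat_of_forall_divisorClasses_powPeriod_eq_hodgeClasses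
    (hD : ∀ k p : ℕ, divisorClasses (powPeriod Ψ k) p = hodgeClasses (powPeriod Ψ k) p) (hA : IsAbelianVariety Ψ')
    (h3 : finrank ℂ E' = 3) (hT : IsSimple Ψ') {hτ : τ.im ≠ 0} (hE : ellipticEnd hτ ≠ ⊥)
    (hiso : IsIsogenous Ψ (prodPeriod Ψ' (ellipticPeriod hτ))) : IsEmpty (Algebra.adjoin ℚ {τ} →ₐ[ℚ] endAlgRat Ψ') := by
  refine not_nonempty_iff.1 fun hemb ↦ ?_
  obtain ⟨k, p, hkp⟩ :=
    hiso.exists_divisorClasses_powPeriod_ne_hodgeClasses_of_prod_ellipticPeriod_of_nonempty_algHom hT hA h3 hE hemb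
  exact hkp (hD k p)

end CaseA

/-! ## §4 Non-simple abelian fourfolds: (D) ⟺ `Hg(X) = Sp_D(V,φ)` ⟺ not case (a) (Thm. (0.1) (1) + (4)) -/

section Fourfold

variable {κ : Type} [Fintype κ] [DecidableEq κ] {E : Type} [NormedAddCommGroup E] [NormedSpace ℂ E]
  [FiniteDimensional ℂ E] {Ψ : (κ → ℝ) ≃L[ℝ] E} {η : E [⋀^Fin 2]→L[ℝ] ℝ}

/-- **MOONEN–ZARHIN THM. (0.1) (1) + (4) FOR NON-SIMPLE FOURFOLDS: (D) ⟺ NOT CASE (a).**  For a polarised complex abelian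
fourfold `X` which is not simple: `ℬᵖ(Xᵏ) = 𝒟ᵖ(Xᵏ)` for all `k, p` if and only if for every simple polarised complex abelian
threefold `T` and every `E_τ` with complex multiplication such that `X ∼ T × E_τ` there is no embedding
`ℚ[τ] = End⁰(E_τ) ↪ End⁰(T)`. [cite: MoonenZarhin1999LowDim, Thm. (0.1) (1), (4) (p0001 L102–L105, L120–L125), Introduction (a) (p0001 L77–L80), §5 (5.2)–(5.5)] -/
theorem IsRiemannForm.forall_divisorClasses_powPeriod_eq_hodgeClasses_iff_forall_isEmpty_algHom_of_not_isSimple_of_finrank_eq_four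
    (hη : IsRiemannForm Ψ η) (h4 : finrank ℂ E = 4) (hX : ¬ IsSimple Ψ) :
    (∀ k p : ℕ, divisorClasses (powPeriod Ψ k) p = hodgeClasses (powPeriod Ψ k) p) ↔
      ∀ {κ' : Type} [Fintype κ'] [DecidableEq κ'] {E' : Type} [NormedAddCommGroup E'] [NormedSpace ℂ E']
        [FiniteDimensional ℂ E'] {Ψ' : (κ' → ℝ) ≃L[ℝ] E'} {η' : E' [⋀^Fin 2]→L[ℝ] ℝ}, IsRiemannForm Ψ' η' →
        finrank ℂ E' = 3 → IsSimple Ψ' → ∀ {τ : ℂ} (hτ : τ.im ≠ 0), ellipticEnd hτ ≠ ⊥ →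
        IsIsogenous Ψ (prodPeriod Ψ' (ellipticPeriod hτ)) → IsEmpty (Algebra.adjoin ℚ {τ} →ₐ[ℚ] endAlgRat Ψ') := by
  refine ⟨fun hD ↦ ?_, fun ha ↦ hη.forall_divisorClasses_powPeriod_eq_hodgeClasses_of_not_isSimple_of_finrank_eq_four h4 hX ha⟩
  intro κ' _ _ E' _ _ _ Ψ' η' hη' h3 hT τ hτ hE hiso
  exact isEmpty_algHom_adjoin_endAlgRat_of_forall_divisorClasses_powPeriod_eq_hodgeClasses hD ⟨_, hη'⟩ h3 hT hE hiso

/-- **MOONEN–ZARHIN THM. (0.1) FOR NON-SIMPLE FOURFOLDS, THE HODGE GROUP: `Hg(X) = Sp_D(V,φ)` ⟺ (D)** — for a polarised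
complex abelian fourfold which is not simple, `Hg(X)(ℝ) = S(X)(ℝ)` (the centraliser of `End⁰(X)` in `Sp(V,φ)`, real points)
if and only if `ℬᵖ(Xᵏ) = 𝒟ᵖ(Xᵏ)` for all `k, p` (in case (a) `Hg ⊊ Sp_D` and (D) fails; otherwise `Hg = Sp_D` and (D)
holds). [cite: MoonenZarhin1999LowDim, Thm. (0.1) (1), (4) (p0001 L102–L105, L120–L122)] [cite: Gordon1999HodgeAVSurvey, Thm. 7.5 (1) ⟺ (2)]
[cite: Milne1999LefschetzClasses, §4 Prop. 4.8] -/
theorem IsRiemannForm.hodgeGroup_eq_lefschetzGroup_iff_forall_divisorClasses_powPeriod_eq_hodgeClasses_of_not_isSimple_of_finrank_eq_four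
    (hη : IsRiemannForm Ψ η) (h4 : finrank ℂ E = 4) (hX : ¬ IsSimple Ψ) :
    hodgeGroup Ψ = lefschetzGroup Ψ η ↔ ∀ k p : ℕ, divisorClasses (powPeriod Ψ k) p = hodgeClasses (powPeriod Ψ k) p := by
  refine ⟨fun h ↦ ?_, fun hD ↦ ?_⟩
  · -- `Hg = S` ⟹ not case (a) ⟹ (D)
    refine hη.forall_divisorClasses_powPeriod_eq_hodgeClasses_of_not_isSimple_of_finrank_eq_four h4 hX ?_
    intro κ' _ _ E' _ _ _ Ψ' η' hη' h3 hT τ hτ hE hiso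
    refine not_nonempty_iff.1 fun hemb ↦ ?_
    exact (hiso.hodgeGroup_lt_lefschetzGroup_of_prod_ellipticPeriod_of_nonempty_algHom hη hT ⟨_, hη'⟩ h3 hE hemb).ne h
  · -- (D) ⟹ `Hg = S` (Gordon's Thm. 7.5 (1) ⟹ (2))
    obtain ⟨G, hG⟩ := hη.exists_ratMatrix_latticeGram
    have hE : 0 < finrank ℂ E := by rw [h4]; norm_num
    exact ((hη.forall_divisorClasses_powPeriod_eq_hodgeClasses_iff_eq_and_hodgeGroup_eq_lefschetzGroup hG hE).1 hD).2

/-- **THM. (0.1) FOR NON-SIMPLE FOURFOLDS: `Hg(X) = Sp_D(V,φ)` ⟺ NOT CASE (a).** [cite: MoonenZarhin1999LowDim, Thm. (0.1) (1), (4) (p0001 L102–L105, L120–L122) and Introduction (a)] -/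
theorem IsRiemannForm.hodgeGroup_eq_lefschetzGroup_iff_forall_isEmpty_algHom_of_not_isSimple_of_finrank_eq_four
    (hη : IsRiemannForm Ψ η) (h4 : finrank ℂ E = 4) (hX : ¬ IsSimple Ψ) :
    hodgeGroup Ψ = lefschetzGroup Ψ η ↔
      ∀ {κ' : Type} [Fintype κ'] [DecidableEq κ'] {E' : Type} [NormedAddCommGroup E'] [NormedSpace ℂ E']
        [FiniteDimensional ℂ E'] {Ψ' : (κ' → ℝ) ≃L[ℝ] E'} {η' : E' [⋀^Fin 2]→L[ℝ] ℝ}, IsRiemannForm Ψ' η' →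
        finrank ℂ E' = 3 → IsSimple Ψ' → ∀ {τ : ℂ} (hτ : τ.im ≠ 0), ellipticEnd hτ ≠ ⊥ →
        IsIsogenous Ψ (prodPeriod Ψ' (ellipticPeriod hτ)) → IsEmpty (Algebra.adjoin ℚ {τ} →ₐ[ℚ] endAlgRat Ψ') :=
  (hη.hodgeGroup_eq_lefschetzGroup_iff_forall_divisorClasses_powPeriod_eq_hodgeClasses_of_not_isSimple_of_finrank_eq_four h4 hX).trans
    (hη.forall_divisorClasses_powPeriod_eq_hodgeClasses_iff_forall_isEmpty_algHom_of_not_isSimple_of_finrank_eq_four h4 hX)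

/-- **FAILURE OF (D) ⟺ CASE (a), WITH WITNESSES INSIDE `X`**: a non-simple polarised complex abelian fourfold `X` carries, on
some power, a Hodge class which is not a polynomial in divisor classes iff `X` contains a Poincaré subtorus `T = π(V)` which
is a simple polarised abelian threefold and there is `τ ∈ ℂ ∖ ℝ` with `E_τ` of CM type, `X ∼ T × E_τ` and
`ℚ[τ] ↪ End⁰(T)`. [cite: MoonenZarhin1999LowDim, Thm. (0.1) (1), (4) (p0001 L102–L105, L120–L125), Introduction (a) (p0001 L77–L80)]
[cite: Lange2023AbelianVarietiesComplex, §2.4.4 Thm. 2.4.25 and Cor. 2.4.26] -/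
theorem IsRiemannForm.exists_divisorClasses_powPeriod_ne_hodgeClasses_iff_exists_subtorusPeriod_of_not_isSimple_of_finrank_eq_four
    (hη : IsRiemannForm Ψ η) (h4 : finrank ℂ E = 4) (hX : ¬ IsSimple Ψ) :
    (∃ k p : ℕ, divisorClasses (powPeriod Ψ k) p ≠ hodgeClasses (powPeriod Ψ k) p) ↔
      ∃ (V : Submodule ℝ (κ → ℝ)) (hV : IsLatticeSubspace V) (hVc : IsComplexSubspace Ψ V) (τ : ℂ) (hτ : τ.im ≠ 0),
        finrank ℂ (cxSpan Ψ V) = 3 ∧ IsSimple (subtorusPeriod Ψ V hV hVc) ∧ ellipticEnd hτ ≠ ⊥ ∧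
          IsIsogenous Ψ (prodPeriod (subtorusPeriod Ψ V hV hVc) (ellipticPeriod hτ)) ∧
            Nonempty (Algebra.adjoin ℚ {τ} →ₐ[ℚ] endAlgRat (subtorusPeriod Ψ V hV hVc)) := by
  refine ⟨hη.exists_isIsogenous_subtorusPeriod_prod_ellipticPeriod_of_exists_divisorClasses_powPeriod_ne_of_not_isSimple_of_finrank_eq_four
    h4 hX, ?_⟩
  rintro ⟨V, hV, hVc, τ, hτ, h3, hT, hE, hiso, hemb⟩
  exact hiso.exists_divisorClasses_powPeriod_ne_hodgeClasses_of_prod_ellipticPeriod_of_nonempty_algHom hT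
    ⟨_, isRiemannForm_restrict Ψ hη hV hVc⟩ h3 hE hemb

end Fourfold

end ComplexTorus

end Literature.Geometry.Kaehler
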